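import Summits.KontsevichZagierPeriods.KontsevichZagierPeriods.Theses.TerasomaMultiplication
import Literature.NumberTheory.Transcendental.KZCalculusProofs
import Literature.NumberTheory.Transcendental.KZLogCalculusProofs
import Literature.NumberTheory.Transcendental.KZRelationsLE
import Literature.NumberTheory.Transcendental.KZSubcalculusInvariants
import Literature.NumberTheory.Transcendental.KZMellinFibres

/-!
# Crux `MultiplicationAccessible` (stmt-KontsevichZagierPeriods-12305) — negative knowledge, part 1: core

Landed copy of §§1–4 and §7 of `Cruxes/MultiplicationAccessible/Disproof.lean` (crux disprover,
gen 1). The crux (route TerasomaMultiplication, rank 3): for `m ≥ 1`, rational `s > 0`, the box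
representation `[(0,1)^m, ∏ᵢ xᵢ^((i+1)/(m+1) − 1)(1 − xᵢ)^(s−1)]` and the simplex representation
`[{σ > 0, Σσ < m+1}, (∏σᵢ·(m+1 − Σσᵢ))^(s−1)]` are `KZ.Equivalent`.

* §1 `multiplicationAccessible_iff`, `at_iff_of_witnesses`: the crux is `∀ m ≥ 1, ∀ s > 0, At m s`
  and does not depend on the representatives.
* §2 `at_zero`, `multiplicationAccessible_iff_noGuard`: the guard `1 ≤ m` is decorative (the
  excluded case `m = 0` is true).
* §3 `mem_relations_of_nsmul_mem_relations` (**`FormalRep ⧸ relations` is torsion-free**, from the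
  scaling endomorphism `KZ.scale (1/k)`), `multiplicationAccessible_iff_upToTorsion`: the weakening
  "some `N • ([box] − [simplex])` is a relation" is equivalent to the crux — the integrality /
  torsion failure mode named in the crux docstring cannot refute the statement.
* §4 `multiplicationAccessible_of_summit : ValueIdentity → KontsevichZagierPeriods → crux` and
  `valueIdentity_of_multiplicationAccessible`: given Gauss multiplication (the value identity),
  any refutation of the crux refutes the formalised Conjecture 1.
* §7 `not_isBoxRep_one_of_nonpos`, `at_one_of_nonpos`: for `s ≤ 0` no box representation exists at
  `m = 1` (non-integrability at `x = 1`), so below the guard `0 < s` the crux is vacuous, not false.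

Reference: M. Kontsevich, D. Zagier, *Periods* (2001), §1.2; G. Andrews, R. Askey, R. Roy,
*Special Functions* (1999), Thm 1.5.2 (Gauss multiplication).
-/

noncomputable section

open MeasureTheory Set
open Literature.NumberTheory.Transcendental
open Literature.NumberTheory.Transcendental.KZ
open Summit.KontsevichZagierPeriods.KontsevichZagierPeriods.Theses.TerasomaMultiplication
  (MultiplicationAccessible)

namespace Summit.KontsevichZagierPeriods.MultiplicationAccessible.Negative

variable {m n : ℕ} {s : ℚ}

/-! ## §1 Vocabulary, unfolding, representative-independence -/

/-- The box domain `(0,1)^m` of the crux, token for token. [folklore] -/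
def boxDom (m : ℕ) : Set (Fin m → ℝ) := {x | ∀ i, x i ∈ Set.Ioo (0:ℝ) 1}

/-- The box integrand `∏ᵢ xᵢ^((i+1)/(m+1) − 1) (1 − xᵢ)^(s−1)` of the crux, token for token. [folklore] -/
def boxFun (m : ℕ) (s : ℚ) : (Fin m → ℝ) → ℝ :=
  fun x => ∏ i : Fin m, (x i) ^ ((((i:ℕ):ℝ) + 1) / ((m:ℝ) + 1) - 1) * (1 - x i) ^ ((s:ℝ) - 1)

/-- The simplex domain `{σ > 0, Σσ < m+1}` of the crux, token for token. [folklore] -/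
def simplexDom (m : ℕ) : Set (Fin m → ℝ) := {x | (∀ i, 0 < x i) ∧ ∑ i, x i < (m:ℝ) + 1}

/-- The simplex integrand `(∏σᵢ · (m+1 − Σσᵢ))^(s−1)` of the crux, token for token. [folklore] -/
def simplexFun (m : ℕ) (s : ℚ) : (Fin m → ℝ) → ℝ :=
  fun x => ((∏ i, x i) * ((m:ℝ) + 1 - ∑ i, x i)) ^ ((s:ℝ) - 1)

/-- `r` is a box representation of the crux at `(m, s)`. [folklore] -/
def IsBoxRep (m : ℕ) (s : ℚ) (r : IntegralRep m) : Prop :=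
  r.domain = boxDom m ∧ EqOn r.integrand (boxFun m s) r.domain

/-- `r'` is a simplex representation of the crux at `(m, s)`. [folklore] -/
def IsSimplexRep (m : ℕ) (s : ℚ) (r' : IntegralRep m) : Prop :=
  r'.domain = simplexDom m ∧ EqOn r'.integrand (simplexFun m s) r'.domain

/-- The instance of the crux at the parameter `(m, s)` (no guards). [folklore] -/
def At (m : ℕ) (s : ℚ) : Prop :=
  ∀ r r' : IntegralRep m, IsBoxRep m s r → IsSimplexRep m s r' → Equivalent r r'

/-- **The crux, unfolded**: `MultiplicationAccessible` is the conjunction of its instances `At m s`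
over `m ≥ 1`, `s > 0`. [folklore] -/
theorem multiplicationAccessible_iff :
    MultiplicationAccessible ↔ ∀ (m : ℕ) (s : ℚ), 1 ≤ m → 0 < s → At m s := by
  constructor
  · intro h m s hm hs r r' hr hr'
    exact h m s hm hs r r' hr.1 hr.2 hr'.1 hr'.2
  · intro h m s hm hs r r' hd hi hd' hi'
    exact h m s hm hs r r' ⟨hd, hi⟩ ⟨hd', hi'⟩

/-- Two box representations at the same `(m, s)` differ by a relation (integrand additivity against
a zero representation): the crux does not depend on the representative. [folklore] -/
theorem IsBoxRep.of_sub_of_mem_relations {r₁ r₂ : IntegralRep m} (h₁ : IsBoxRep m s r₁)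
    (h₂ : IsBoxRep m s r₂) : of r₁ - of r₂ ∈ relations :=
  of_sub_of_mem_relations_of_eqOn (by rw [h₁.1, h₂.1]) fun x hx => by
    rw [h₁.2 hx, h₂.2 (by rw [h₂.1, ← h₁.1]; exact hx)]

/-- Two simplex representations at the same `(m, s)` differ by a relation. [folklore] -/
theorem IsSimplexRep.of_sub_of_mem_relations {r₁ r₂ : IntegralRep m} (h₁ : IsSimplexRep m s r₁)
    (h₂ : IsSimplexRep m s r₂) : of r₁ - of r₂ ∈ relations :=
  of_sub_of_mem_relations_of_eqOn (by rw [h₁.1, h₂.1]) fun x hx => by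
    rw [h₁.2 hx, h₂.2 (by rw [h₂.1, ← h₁.1]; exact hx)]

/-- **Representative-independence**: given ONE box representation `r₀` and ONE simplex
representation `r₀'` at `(m, s)`, the instance `At m s` is exactly `Equivalent r₀ r₀'`. [folklore] -/
theorem at_iff_of_witnesses {r₀ r₀' : IntegralRep m} (h₀ : IsBoxRep m s r₀)
    (h₀' : IsSimplexRep m s r₀') : At m s ↔ Equivalent r₀ r₀' := by
  refine ⟨fun h => h r₀ r₀' h₀ h₀', fun h r r' hr hr' => ?_⟩
  have h1 : Equivalent r r₀ := hr.of_sub_of_mem_relations h₀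
  have h2 : Equivalent r₀' r' := h₀'.of_sub_of_mem_relations hr'
  exact h1.trans (h.trans h2)

/-! ## §2 Load-bearing analysis, part 1: the guard `1 ≤ m` is decorative -/

/-- **The excluded degenerate case `m = 0` is TRUE**: in dimension `0` both domains are the
one-point space and both integrands are `1` on it, so the two representations differ by a
relation. Hence no proof needs the guard `1 ≤ m`. [folklore] -/
theorem at_zero (s : ℚ) : At 0 s := by
  intro r r' hr hr'
  have hd : r'.domain = r.domain := by
    rw [hr.1, hr'.1]
    ext x
    simp [boxDom, simplexDom]
  refine of_sub_of_mem_relations_of_eqOn hd fun x hx => ?_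
  rw [hr.2 hx, hr'.2 (hd ▸ hx)]
  simp [boxFun, simplexFun]

/-- The crux with the guard `1 ≤ m` removed is equivalent to the crux. [folklore] -/
theorem multiplicationAccessible_iff_noGuard :
    MultiplicationAccessible ↔ ∀ (m : ℕ) (s : ℚ), 0 < s → At m s := by
  rw [multiplicationAccessible_iff]
  refine ⟨fun h m s hs => ?_, fun h m s _ hs => h m s hs⟩
  rcases Nat.eq_zero_or_pos m with rfl | hm
  · exact at_zero s
  · exact h m s hm hs

/-! ## §3 The torsion escape is closed: `FormalRep ⧸ relations` is torsion-free -/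

section Torsion

/-- The algebraic constant `1/k`. [folklore] -/
theorem isAlgebraic_inv_nat (k : ℕ) : IsAlgebraic ℚ ((k : ℝ)⁻¹) :=
  IsAlgebraic.inv_iff.mpr (isAlgebraic_nat k)

/-- Generatorwise: `[σ, f] − k • [σ, f/k]` is a relation (`[σ, k·(f/k)] − k•[σ, f/k]` is integrand
additivity, `KZ.IntegralRep.of_constMul_nat_sub_nsmul_mem_relations`, and `[σ, f] − [σ, k·(f/k)]`
is congruence). [cite: KontsevichZagier2001, §1.2 rule (1)] -/
theorem of_sub_nsmul_of_constMul_inv_mem_relations (r : IntegralRep n) {k : ℕ} (hk : k ≠ 0) :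
    of r - k • of (r.constMul ((k : ℝ)⁻¹) (isAlgebraic_inv_nat k)) ∈ relations := by
  set r₁ := r.constMul ((k : ℝ)⁻¹) (isAlgebraic_inv_nat k) with hr₁
  have h1 : of (r₁.constMul (k : ℝ) (isAlgebraic_nat k)) - k • of r₁ ∈ relations :=
    IntegralRep.of_constMul_nat_sub_nsmul_mem_relations r₁ k
  have h2 : of r - of (r₁.constMul (k : ℝ) (isAlgebraic_nat k)) ∈ relations := by
    refine of_sub_of_mem_relations_of_eqOn rfl fun x _ => ?_
    have hk' : (k : ℝ) ≠ 0 := Nat.cast_ne_zero.mpr hk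
    simp only [hr₁, IntegralRep.integrand_constMul]
    rw [← mul_assoc, mul_inv_cancel₀ hk', one_mul]
  have : of r - k • of r₁ = (of r - of (r₁.constMul (k : ℝ) (isAlgebraic_nat k))) +
      (of (r₁.constMul (k : ℝ) (isAlgebraic_nat k)) - k • of r₁) := by abel
  rw [this]
  exact relations.add_mem h2 h1

/-- Every formal combination `c` is congruent to `k • scale (1/k) c` modulo relations.
[cite: KontsevichZagier2001, §1.2 rule (1)] -/
theorem sub_nsmul_scale_inv_mem_relations {k : ℕ} (hk : k ≠ 0) (c : FormalRep) :
    c - k • scale ((k : ℝ)⁻¹) (isAlgebraic_inv_nat k) c ∈ relations := by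
  induction c using FreeAbelianGroup.induction_on with
  | zero => simp
  | of x =>
    obtain ⟨n, r⟩ := x
    change of r - k • scale ((k : ℝ)⁻¹) (isAlgebraic_inv_nat k) (of r) ∈ relations
    rw [scale_of]
    exact of_sub_nsmul_of_constMul_inv_mem_relations r hk
  | neg x hx =>
    obtain ⟨n, r⟩ := x
    change -of r - k • scale ((k : ℝ)⁻¹) (isAlgebraic_inv_nat k) (-of r) ∈ relations
    have : -of r - k • scale ((k : ℝ)⁻¹) (isAlgebraic_inv_nat k) (-of r) =
        -(of r - k • scale ((k : ℝ)⁻¹) (isAlgebraic_inv_nat k) (of r)) := by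
      rw [map_neg, smul_neg]; abel
    rw [this]
    exact relations.neg_mem hx
  | add x y hx hy =>
    have : x + y - k • scale ((k : ℝ)⁻¹) (isAlgebraic_inv_nat k) (x + y) =
        (x - k • scale ((k : ℝ)⁻¹) (isAlgebraic_inv_nat k) x) +
        (y - k • scale ((k : ℝ)⁻¹) (isAlgebraic_inv_nat k) y) := by
      rw [map_add, smul_add]; abel
    rw [this]
    exact relations.add_mem hx hy

/-- **`FormalRep ⧸ relations` is torsion-free** (route CoactionDevissage's support item
`TorsionFree`, proved here in five lines from the scaling endomorphism `KZ.scale (1/k)`):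
if `k • c` is a relation for some `k ≠ 0`, then `c` is a relation — although "division by an
integer" is not a rule. Consequence for this crux: the failure mode "only `N·([r] − [r'])` is
derivable" named in the crux docstring CANNOT refute the statement; an `N`-fold chain is as good
as a chain. [cite: KontsevichZagier2001, §1.2] -/
theorem mem_relations_of_nsmul_mem_relations {k : ℕ} (hk : k ≠ 0) {c : FormalRep}
    (h : k • c ∈ relations) : c ∈ relations := by
  have h1 := sub_nsmul_scale_inv_mem_relations hk c
  have h2 : k • scale ((k : ℝ)⁻¹) (isAlgebraic_inv_nat k) c ∈ relations := by
    rw [← map_nsmul]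
    exact scale_mem_relations _ _ h
  simpa using relations.add_mem h1 h2

/-- Integer version of torsion-freeness. [cite: KontsevichZagier2001, §1.2] -/
theorem mem_relations_of_zsmul_mem_relations {k : ℤ} (hk : k ≠ 0) {c : FormalRep}
    (h : k • c ∈ relations) : c ∈ relations := by
  have hk0 : k.natAbs ≠ 0 := by simpa using hk
  rcases Int.natAbs_eq k with hk' | hk'
  · rw [hk', natCast_zsmul] at h
    exact mem_relations_of_nsmul_mem_relations hk0 h
  · rw [hk', neg_smul, natCast_zsmul] at h
    exact mem_relations_of_nsmul_mem_relations hk0 (relations.neg_mem_iff.mp h)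

/-- The crux "up to torsion" (a WEAKENING, refuted as a weakening below: it is equivalent to the
crux): some non-zero multiple of `[box] − [simplex]` is a relation. -/
def UpToTorsion : Prop :=
  ∀ (m : ℕ) (s : ℚ), 1 ≤ m → 0 < s → ∀ r r' : IntegralRep m, IsBoxRep m s r → IsSimplexRep m s r' →
    ∃ N : ℕ, N ≠ 0 ∧ N • (of r - of r') ∈ relations

/-- **The natural weakening "up to torsion" is NOT weaker**: it is equivalent to the crux. So the
integrality worry of the route ("O–Y divide by (n−1)! and invert motives: then only
N·([r]−[r']) ∈ relations") is harmless for the STATEMENT (it may still shape the chain). [folklore] -/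
theorem multiplicationAccessible_iff_upToTorsion : MultiplicationAccessible ↔ UpToTorsion := by
  rw [multiplicationAccessible_iff]
  refine ⟨fun h m s hm hs r r' hr hr' => ⟨1, one_ne_zero, ?_⟩, fun h m s hm hs r r' hr hr' => ?_⟩
  · rw [one_nsmul]
    exact h m s hm hs r r' hr hr'
  obtain ⟨N, hN, hmem⟩ := h m s hm hs r r' hr hr'
  exact mem_relations_of_nsmul_mem_relations hN hmem

end Torsion

/-! ## §4 No cheap kill: a refutation of the crux refutes the summit -/

/-- The value identity behind the crux, in representation form: Gauss's multiplication formula in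
Beta form, `∏_{k=1}^{m} B(k/(m+1), s) = (m+1)^{(m+1)s−1} Γ(s)^{m+1} / Γ((m+1)s)` = the Dirichlet
value of the simplex side (classical: Andrews–Askey–Roy 1999 Thm 1.5.2; NOT in Mathlib beyond
`m = 1`). A HYPOTHESIS of the reduction below, not asserted. -/
def ValueIdentity : Prop :=
  ∀ (m : ℕ) (s : ℚ), 1 ≤ m → 0 < s → ∀ r r' : IntegralRep m, IsBoxRep m s r → IsSimplexRep m s r' →
    r.value = r'.value

/-- The crux implies the value identity (soundness of the calculus, proved in the tree). [folklore] -/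
theorem valueIdentity_of_multiplicationAccessible (h : MultiplicationAccessible) : ValueIdentity :=
  fun m s hm hs r r' hr hr' =>
    Equivalent.value_eq_holds ((multiplicationAccessible_iff.mp h) m s hm hs r r' hr hr')

/-- **The crux is an instance of the summit** given the (classical) value identity: every
representation is equivalent to one of KZ's rational shape (`KZ.exists_isRational_equivalent_holds`,
one Newton–Leibniz graph move), values are preserved, and the summit connects the two rational
representatives. Hence `¬ MultiplicationAccessible → ¬ KontsevichZagierPeriods` (given Gauss
multiplication): any kill here is a refutation of the formalised Conjecture 1 — it needs an additive
invariant of `FormalRep` vanishing on all four move sets and separating a box/simplex pair, and no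
such invariant is known. [cite: KontsevichZagier2001, §1.2 Conjecture 1] -/
theorem multiplicationAccessible_of_summit (hV : ValueIdentity) (hS : KontsevichZagierPeriods) :
    MultiplicationAccessible := by
  rw [multiplicationAccessible_iff]
  intro m s hm hs r r' hr hr'
  obtain ⟨k, ρ, hρ, hrρ⟩ := exists_isRational_equivalent_holds r
  obtain ⟨k', ρ', hρ', hr'ρ'⟩ := exists_isRational_equivalent_holds r'
  have hv : ρ.value = ρ'.value := by
    rw [← Equivalent.value_eq_holds hrρ, ← Equivalent.value_eq_holds hr'ρ']
    exact hV m s hm hs r r' hr hr'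
  exact hrρ.trans ((hS ρ ρ' hρ hρ' hv).trans hr'ρ'.symm)


/-! ## Dimension-1 basics -/

section DimOneBasics

open Literature.ModelTheory.ExponentialFields (IsSemialgebraic)

/-- The coordinate `x ↦ x 0` on `ℝ¹` is the measurable equivalence `funUnique`. [folklore] -/
theorem funUnique_apply (x : Fin 1 → ℝ) : MeasurableEquiv.funUnique (Fin 1) ℝ x = x 0 := by
  simp [MeasurableEquiv.funUnique, Fin.default_eq_zero]

/-- In dimension `1` the box is the preimage of `(0, 1)`. [folklore] -/
theorem boxDom_one_eq : boxDom 1 = MeasurableEquiv.funUnique (Fin 1) ℝ ⁻¹' Ioo 0 1 := by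
  ext x
  simp [boxDom, MeasurableEquiv.funUnique, Fin.forall_fin_one, Fin.default_eq_zero]

/-- The box is `ℚ`-semialgebraic (tree: `KZ.isSemialgebraic_box`). [folklore] -/
theorem isSemialgebraic_boxDom (m : ℕ) : IsSemialgebraic ℚ (boxDom m) := isSemialgebraic_box m

/-- The box is measurable. [folklore] -/
theorem measurableSet_boxDom (m : ℕ) : MeasurableSet (boxDom m) :=
  IsSemialgebraic.measurableSet_holds (isSemialgebraic_boxDom m)

end DimOneBasics

/-! ## §7 Load-bearing analysis, part 2: below the guard `0 < s` the crux is VACUOUS -/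

section Vacuity

/-- The box integrand at `m = 1` as a function of `t = x 0`: `t^(−1/2) (1 − t)^(s−1)`. [folklore] -/
theorem boxFun_one_apply (s : ℚ) (x : Fin 1 → ℝ) :
    boxFun 1 s x = (x 0) ^ (-(1:ℝ)/2) * (1 - x 0) ^ ((s:ℝ) - 1) := by
  simp only [boxFun, Fin.prod_univ_one, Fin.val_zero, Nat.cast_zero, Nat.cast_one]
  norm_num

/-- **No box representation exists at `m = 1` for `s ≤ 0`**: absolute convergence (the field
`integrableOn`) fails at `x = 1`, since `x^(−1/2)(1−x)^(s−1) ≥ (1−x)^(s−1)` on `(0,1)` and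
`u ↦ u^(s−1)` is not integrable at `0⁺` for `s − 1 ≤ −1` (`intervalIntegral.integrableOn_Ioo_rpow_iff`).
Hence the instance `At 1 s` is vacuously TRUE for `s ≤ 0`: dropping the guard `0 < s` does not
produce a counterexample — the guard is the honest convergence range, not a load-bearing
hypothesis. [folklore] -/
theorem not_isBoxRep_one_of_nonpos (hs : s ≤ 0) (r : IntegralRep 1) : ¬ IsBoxRep 1 s r := by
  rintro ⟨hd, hi⟩
  have h1 : IntegrableOn (boxFun 1 s) (boxDom 1) := by
    rw [← hd]
    exact r.integrableOn.congr_fun hi (IntegralRep.measurableSet_domain_holds r)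
  -- transport to one real variable
  have h2 : IntegrableOn (fun t : ℝ => t ^ (-(1:ℝ)/2) * (1 - t) ^ ((s:ℝ) - 1)) (Ioo 0 1) := by
    refine ((volume_preserving_funUnique (Fin 1) ℝ).integrableOn_comp_preimage
      (MeasurableEquiv.measurableEmbedding _)).mp ?_
    rw [← boxDom_one_eq]
    refine h1.congr_fun (fun x _ => ?_) (measurableSet_boxDom 1)
    rw [boxFun_one_apply]
    rfl
  -- lower bound by the pure power of `1 - t`
  have h3 : IntegrableOn (fun t : ℝ => (1 - t) ^ ((s:ℝ) - 1)) (Ioo 0 1) := by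
    refine Integrable.mono' h2 ?_ ?_
    · exact ContinuousOn.aestronglyMeasurable
        (fun t ht => (Real.continuousAt_rpow_const _ _ (Or.inl (by linarith [ht.2]))).continuousWithinAt.comp
          (continuousWithinAt_const.sub continuousWithinAt_id) (mapsTo_univ _ _))
        measurableSet_Ioo
    · filter_upwards [ae_restrict_mem measurableSet_Ioo] with t ht
      have hpos : 0 ≤ (1 - t) ^ ((s:ℝ) - 1) := Real.rpow_nonneg (by linarith [ht.2]) _
      rw [Real.norm_of_nonneg hpos]
      have hone : 1 ≤ t ^ (-(1:ℝ)/2) :=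
        Real.one_le_rpow_of_pos_of_le_one_of_nonpos ht.1 ht.2.le (by norm_num)
      calc (1 - t) ^ ((s:ℝ) - 1) = 1 * (1 - t) ^ ((s:ℝ) - 1) := (one_mul _).symm
        _ ≤ t ^ (-(1:ℝ)/2) * (1 - t) ^ ((s:ℝ) - 1) := mul_le_mul_of_nonneg_right hone hpos
  -- reflect `u = 1 - t`
  have h4 : IntegrableOn (fun u : ℝ => u ^ ((s:ℝ) - 1)) (Ioo 0 1) := by
    have h3' : IntervalIntegrable (fun t : ℝ => (1 - t) ^ ((s:ℝ) - 1)) volume 0 1 :=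
      (intervalIntegrable_iff_integrableOn_Ioo_of_le zero_le_one).mpr h3
    have h4' := (h3'.comp_sub_left 1).symm
    simp only [sub_sub_cancel, sub_zero, sub_self] at h4'
    exact (intervalIntegrable_iff_integrableOn_Ioo_of_le zero_le_one).mp h4'
  have h5 := (intervalIntegral.integrableOn_Ioo_rpow_iff zero_lt_one).mp h4
  have hs' : (s:ℝ) ≤ 0 := by exact_mod_cast hs
  linarith

/-- Consequently the instance at `m = 1` holds VACUOUSLY for every `s ≤ 0`. [folklore] -/
theorem at_one_of_nonpos (hs : s ≤ 0) : At 1 s :=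
  fun r _ hr _ => (not_isBoxRep_one_of_nonpos hs r hr).elim

end Vacuity

end Summit.KontsevichZagierPeriods.MultiplicationAccessible.Negative
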